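import Summits.Ventures.PackingBounds.Configurations.ListConfig
import Summits.Ventures.PackingBounds.SphericalCodes.Dim5N16
import Summits.Ventures.PackingBounds.Energy.UniversalOptimality

/-!
# The 16-point sharp configuration on `S⁴` (demihypercube): `A(5, arccos 1/5) = 16` and the ground-state energy

Framing: lottery ticket; floor = certified bounds/negative ranges. Venture `PackingBounds` (cell
`pub-packcert`, seat `pub-packcert-energy`) — the **attained side** for `(n, N) = (5, 16)`.

`vecs` lists the `16` vectors `(±1)⁵` with an even number of minus signs (squared length `5`;
normalised, the Clebsch/demihypercube configuration of Cohn–Kumar's Table 1 with inner products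
`-3/5` (5 times) and `1/5` (10 times) around each point). The kernel checks the distance distribution;
with the cell's bounds this gives `A(5, arccos 1/5) = 16` as an `IsGreatest` statement
(`SphericalCodes.code_dim5_le_16`) and the ground-state energy of `16` points on `S⁴` for every
absolutely monotonic potential as an `IsLeast` statement (`Energy.UniversalDim5Card16…`).

## References
* H. Cohn, A. Kumar, J. Amer. Math. Soc. 20 (2007) 99–148, Table 1. [`CohnKumar2006`]
-/

namespace Summit.Ventures.PackingBounds.Config.Dim5Card16

open Finset Summit.Ventures.PackingBounds.Config

set_option maxHeartbeats 4000000 in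
/-- The `16` sign vectors `(±1)⁵` with an even number of minus signs. [cite: CohnKumar2006, Table 1] -/
def vecs : List (List ℤ) := [
  [1, 1, 1, 1, 1],
  [1, 1, 1, -1, -1],
  [1, 1, -1, 1, -1],
  [1, 1, -1, -1, 1],
  [1, -1, 1, 1, -1],
  [1, -1, 1, -1, 1],
  [1, -1, -1, 1, 1],
  [1, -1, -1, -1, -1],
  [-1, 1, 1, 1, -1],
  [-1, 1, 1, -1, 1],
  [-1, 1, -1, 1, 1],
  [-1, 1, -1, -1, -1],
  [-1, -1, 1, 1, 1],
  [-1, -1, 1, -1, -1],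
  [-1, -1, -1, 1, -1],
  [-1, -1, -1, -1, 1]]

/-- The distance table: dot products of a member with the other members, with multiplicities. -/
def table : List (ℤ × ℕ) := [(-3, 5), (1, 10)]

/-- Kernel check: `16` coordinate lists. -/
theorem length_vecs : vecs.length = 16 := by decide +kernel

set_option maxRecDepth 100000 in
/-- Kernel check: the coordinate lists are pairwise distinct. -/
theorem nodup_vecs : vecs.Nodup := by decide +kernel

set_option maxRecDepth 100000 in
/-- Kernel check: every list has length `5` and the prescribed squared length. -/
theorem shape_vecs : shapeOK vecs 5 (5 : ℤ) = true := by decide +kernel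

/-- Kernel check: the table keys are distinct and differ from the squared length. -/
theorem keys_table : keysOK table (5 : ℤ) = true := by decide +kernel

set_option maxRecDepth 100000 in
/-- Kernel check (the distance distribution): the dot products of every member with the other members
have exactly the tabulated multiplicities and take no other value. -/
theorem hist_vecs : histOK vecs table vecs = true := by decide +kernel

/-- The configuration: the normalised coordinate lists as points of `ℝ^5`. -/
noncomputable def pts : Finset (EuclideanSpace ℝ (Fin 5)) := config (Int.castRingHom ℝ) 5 (5 : ℤ) vecs

/-- `ι q > 0`. -/
private theorem hq : 0 < (Int.castRingHom ℝ) (5 : ℤ) := by simp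

/-- `pts` has `16` points. -/
theorem card_pts : pts.card = 16 := by
  rw [pts, card_eq Int.cast_injective hq shape_vecs keys_table hist_vecs nodup_vecs, length_vecs]

/-- Every point of `pts` is a unit vector. -/
private theorem norm_pts : ∀ x ∈ pts, ‖x‖ = 1 := norm_eq_one hq shape_vecs

/-- Distinct points of `pts` have inner product `ι d / ι q` for a key `d` of the table. -/
theorem inner_pts : ∀ x ∈ pts, ∀ y ∈ pts, x ≠ y → ∃ p ∈ table, inner ℝ x y = (Int.castRingHom ℝ) p.1 / (Int.castRingHom ℝ) (5 : ℤ) :=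
  inner_mem hq shape_vecs hist_vecs

/-- **Energy of the configuration**: for every potential `a`, `Σ_{x ≠ y ∈ pts} a(⟪x,y⟫)` equals the
tabulated value. -/
theorem energy_pts (a : ℝ → ℝ) :
    ∑ x ∈ pts, ∑ y ∈ pts.erase x, a (inner ℝ x y) =
      (16 : ℝ) * (5 * a (-3 / 5) + 10 * a (1 / 5)) := by
  rw [pts, energy_eq Int.cast_injective hq shape_vecs keys_table hist_vecs nodup_vecs a, length_vecs]
  simp only [table, List.map_cons, List.map_nil, List.sum_cons, List.sum_nil, Nat.cast_ofNat]
  norm_num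

/-- Distinct points of `pts` have inner product `≤ 1 / 5`. -/
theorem inner_pts_le : ∀ x ∈ pts, ∀ y ∈ pts, x ≠ y → inner ℝ x y ≤ 1 / 5 := by
  refine inner_le hq shape_vecs hist_vecs (1 / 5) fun p hp => ?_
  simp only [table, List.mem_cons, List.not_mem_nil, or_false] at hp
  rcases hp with rfl | rfl <;> norm_num

/-- **Attained**: `16` unit vectors of `ℝ⁵` with pairwise inner products `≤ 1/5`. [cite: CohnKumar2006, Table 1] -/
theorem exists_code_16 : ∃ C : Finset (EuclideanSpace ℝ (Fin 5)),
    C.card = 16 ∧ (∀ x ∈ C, ‖x‖ = 1) ∧ (∀ x ∈ C, ∀ y ∈ C, x ≠ y → inner ℝ x y ≤ 1 / 5) :=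
  ⟨pts, card_pts, norm_pts, inner_pts_le⟩

/-- **`A(5, arccos 1/5) = 16`** (two-sided: kernel-checked LP bound + this configuration). [cite: CohnKumar2006, Table 1] -/
theorem code_isGreatest : IsGreatest {N : ℕ | ∃ C : Finset (EuclideanSpace ℝ (Fin 5)), C.card = N ∧ (∀ x ∈ C, ‖x‖ = 1) ∧
      (∀ x ∈ C, ∀ y ∈ C, x ≠ y → inner ℝ x y ≤ 1 / 5)} 16 := by
  refine ⟨exists_code_16, ?_⟩
  rintro N ⟨C, rfl, h1, h2⟩
  exact SphericalCodes.code_dim5_le_16 C h1 h2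

/-- **Ground-state energy of `16` points on `S⁴`** for every absolutely monotonic potential (universal optimality lower bound + attained). [cite: CohnKumar2006, Theorem 1.2] -/
theorem energy_isLeast (a : ℝ → ℝ) (ha : AbsolutelyMonotoneOn a (Set.Ico (-1) 1)) :
    IsLeast {E : ℝ | ∃ C : Finset (EuclideanSpace ℝ (Fin 5)), (∀ x ∈ C, ‖x‖ = 1) ∧ C.card = 16 ∧
      E = ∑ x ∈ C, ∑ y ∈ C.erase x, a (inner ℝ x y)}
      ((16 : ℝ) * (5 * a (-3 / 5) + 10 * a (1 / 5))) := by
  refine ⟨⟨pts, norm_pts, card_pts, (energy_pts a).symm⟩, ?_⟩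
  rintro E ⟨C, h1, hN, rfl⟩
  exact Energy.UniversalDim5Card16.universallyOptimal_of_absolutelyMonotoneOn a ha C h1 hN

end Summit.Ventures.PackingBounds.Config.Dim5Card16
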